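import Literature.AnabelianGeometry.EtaleTheta.Discharge.Sec2ModelCor219
import Literature.AnabelianGeometry.SemiGraphs.TemperedCurveBridge
import Literature.AnabelianGeometry.SemiGraphs.TemperedOpenMapping
import HarnessLib

/-!
# [EtTh] Cor. 2.19 (ii)/(i) for the §1 MODEL: the binders `hslimX`, `haugOpen` from the §6 PARAMETER bundle

Mochizuki, *The Étale Theta Function …* [EtTh], Publ. RIMS 45 (2009), §2, Cor. 2.19 (i), (ii) pp. 64–66
[cite: MochizukiEtTh2009, Cor 2.19 (ii) p.64]; [SemiAnbd] Ex. 3.10 pp. 43–45 ("`Π` tempered, temp-slim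
… `1 → π₁^temp(X_K̄) → π₁^temp(X_K) → G_K → 1`") [cite: MochizukiSemiAnbd2006, Ex 3.10 p.43].
PROOF-ONLY companion of abc-iut-L2-d1's `Sec2ModelCor219.lean` / `Sec2ModelCor219Origin.lean` (lane C2
capstone; nothing there is edited).

Those conditional discharges carry two ad-hoc binders on the [EtTh] §1 theta setting `D`:
`hslimX : IsSlimGroup Π^tp_X` and `haugOpen : IsOpenMap (Π^tp_X → G_{ℚ_p})`.  Both are properties of
`Π^tp_X` recorded by abc-iut-L3's §6 parameter bundle `TemperedCurve.GroupLevelData` (ruling η′: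
"`Π^temp` tempered, temp-slim, Galois-countable" — parameters, not facts): `hslimX` is its field
`isSlimGroup`, and `haugOpen` is a THEOREM from `isTempered` + `secondCountableTopology` by the open
mapping theorem for tempered groups (`TemperedCurve.isOpenMap_aug_of_groupLevelData`,
`SemiGraphs/TemperedOpenMapping.lean`).  The versions below take `d : D.toTemperedCurve.GroupLevelData`
in place of the two binders; all other inputs are unchanged (FACT-policy Cor. 2.18 (i), the named fact
Cor. 2.19 (iii), the origin hypotheses `IsEtThOrigin`, `hYcl`, …).
HONEST FRAMING: conditional discharge; no side is taken on [IUTchIII] Cor. 3.12; typed ≠ discharged.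
-/

noncomputable section

namespace Literature.AnabelianGeometry.EtaleTheta

open Literature.AnabelianGeometry.SemiGraphs
open Literature.AlgebraicGeometry.Frobenioids (IsSlimGroup)

namespace ThetaSetting.EtaleThetaData.DoubleUnderline

variable {p : ℕ} [Fact p.Prime] {D : ThetaSetting p} {E : D.EtaleThetaData} {l : ℕ}
  (C : E.DoubleUnderline l) {Es : Set ℕ+} (τ : D.CyclotomeTower l Es)

/-- **Cor. 2.19 (ii) for the §1 MODEL tower, modulo FACT-policy inputs, with `Π^tp_X` temp-slim /
tempered / Galois-countable supplied by the §6 parameter bundle `d`** (no `hslimX`, `haugOpen`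
binders): as abc-iut-L2-d1's `cor219_ii_model_of_facts`. [cite: MochizukiEtTh2009, Cor 2.19 (ii) p.64] -/
theorem cor219_ii_model_of_facts_of_groupLevelData (d : D.toTemperedCurve.GroupLevelData)
    (hC : D.Compat) (hS : D.Sec2Hyps) (h15 : Prop15iii E hC)
    (h15ii : Prop15ii E.toKummerData hC) (L : C.CuspLabels)
    (h218i : ∀ M : Es, (C.rigidData (τ.mod M) hC hS h15 L).Cor218_i)
    (h219iii : (C.thetaEnvTower τ hC hS).Cor219_iii)
    (hO : D.IsEtThOrigin)
    (hYcl : (D.DtpY.map D.toHat.toMonoidHom).topologicalClosure ≤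
      D.DtpY.map D.toHat.toMonoidHom ⊔ (⁅⁅D.DeltaHat, D.DeltaHat⁆, D.DeltaHat⁆).topologicalClosure) :
    (C.thetaEnvTower τ hC hS).Cor219_ii :=
  C.cor219_ii_model_of_facts τ hC hS h15 h15ii L d.isSlimGroup
    (D.toTemperedCurve.isOpenMap_aug_of_groupLevelData d) h218i h219iii hO hYcl

/-- **Cor. 2.19 (ii) for the §1 MODEL tower with Prop. 2.14 (i) discharged (origin form), `Π^tp_X`
inputs from the §6 parameter bundle `d`**: as `cor219_ii_model_of_origin`.
[cite: MochizukiEtTh2009, Cor 2.19 (ii) p.64] -/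
theorem cor219_ii_model_of_origin_of_groupLevelData (d : D.toTemperedCurve.GroupLevelData)
    (hC : D.Compat) (hS : D.Sec2Hyps) (h15 : Prop15iii E hC) (L : C.CuspLabels)
    (hlift : ∀ M : Es, (C.rigidData (τ.mod M) hC hS h15 L).Cor218_iv_surjective)
    (hO : D.IsEtThOrigin) (hYab : ∀ x ∈ D.DtpYTheta, ∀ y ∈ D.DtpYTheta, x * y = y * x)
    (hYcl : (D.DtpY.map D.toHat.toMonoidHom).topologicalClosure ≤
      D.DtpY.map D.toHat.toMonoidHom ⊔ (⁅⁅D.DeltaHat, D.DeltaHat⁆, D.DeltaHat⁆).topologicalClosure) :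
    (C.thetaEnvTower τ hC hS).Cor219_ii :=
  C.cor219_ii_model_of_origin τ hC hS h15 L d.isSlimGroup
    (D.toTemperedCurve.isOpenMap_aug_of_groupLevelData d) hlift hO hYab hYcl

variable {N : ℕ+} (μ : D.CyclotomeMod l N)

/-- **Cor. 2.19 (i), splittings, for the §1 MODEL, `Π^tp_X` temp-slim from the §6 parameter bundle `d`**:
as `cor219_i_splittings_model_of_origin`. [cite: MochizukiEtTh2009, Cor 2.19 (i) p.64] -/
theorem cor219_i_splittings_model_of_origin_of_groupLevelData (d : D.toTemperedCurve.GroupLevelData)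
    (hC : D.Compat) (hS : D.Sec2Hyps) (h15 : Prop15iii E hC) (L : C.CuspLabels)
    (h218i : (C.rigidData μ hC hS h15 L).Cor218_i)
    (hO : D.IsEtThOrigin) (hYab : ∀ x ∈ D.DtpYTheta, ∀ y ∈ D.DtpYTheta, x * y = y * x)
    (hYcl : (D.DtpY.map D.toHat.toMonoidHom).topologicalClosure ≤
      D.DtpY.map D.toHat.toMonoidHom ⊔ (⁅⁅D.DeltaHat, D.DeltaHat⁆, D.DeltaHat⁆).topologicalClosure) :
    (C.rigidData μ hC hS h15 L).Cor219_i_splittings :=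
  C.cor219_i_splittings_model_of_origin μ hC hS h15 L d.isSlimGroup h218i hO hYab hYcl

end ThetaSetting.EtaleThetaData.DoubleUnderline

end Literature.AnabelianGeometry.EtaleTheta

end
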